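import Literature.Probability.LatticeModels.CollarLegModelSanity
import Literature.Probability.LatticeModels.MedialInterfaceProofs

/-!
# The medial strand representation of the collar leg model (`CollarLegModel`): tracked corners and
# turn factors

Definition layer for the INSERTION DICTIONARY of the closed-collar `Δ = -1/2` height model with leg
insertions (`Literature.Probability.LatticeModels.CollarLegModel`, module docstring (A)–(D3), whose
validation § records the identity `‖Zins V ι‖ = #{ω ⊆ E : rainbow event}` on 106 placements as a
theorem TO BE PROVED): the Baxter–Kelland–Wu reading [BaxterKellandWu1976, §3–§4] of the weight
of a height configuration as a product of TURN FACTORS of oriented level lines on the medial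
lattice, turn by turn, in the corner coding of the tree (`cFace`, `cTgt`, `nextCorner` of
`MedialInterfaceProofs`: the corner `(v, k)` lies at the vertex `v` in the face `faceAt v k` and
arrives at the medial vertex on the edge `cTgt (v, k) = s(v, v + cornerUnit (k+1))`; across a
closed edge the level line turns left around `v` to the corner `(v, k+1)`, along an open edge it
turns right inside the same face to the corner at the far endpoint).

* `CollarLegModel.piece M` — the vertex-cells (`V` and the ghosts) as sites `Fin 2 → ℤ`;
* `CollarLegModel.cfgOf M ω` — the COMPLETED bond configuration of `ω ⊆ E`: `ω` together with
  the frozen open edges (spokes, ghost edges), as a `BondConfig (Site 2)`;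
* `CollarLegModel.IsTracked M c` — the corner `c` is tracked: its vertex is a vertex-cell and its
  face a face-cell (the weights (B), (C), (D1), (D2) of `CollarLegModel` track exactly the turns
  between two tracked corners);
* `CollarLegModel.turnFactor M h β c` — the factor of the turn at the end of the corner `c` in
  the completed configuration `β` for the height configuration `h`: the phase `e^{iμ(h_x - h_f)}`
  (left turn around the vertex-cell `x` across a closed edge, consistent iff the two faces `f, f'`
  it separates from `x` carry the same height) or `e^{iμ(h_f - h_x)}` (right turn inside the
  face-cell `f` along an open edge, consistent iff its two endpoints `x, x'` carry the same
  height); an inconsistent or untracked turn contributes `0` at a LIVE edge (that pairing is absent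
  from the six-vertex weight) and `1` at a FROZEN edge (a defect: two legs end there, rule (D1)).

Proved here: the six-vertex split at a live edge (`liveWeight_eq_turnFactor_split`: rule (B) is
the sum over the two pairings of the products of the turn factors of the two arriving corners
`cIn e`, `cOut e`). Intended downstream (Theorems files of cruxes `BoundaryDefectGaussianR`,
stmt-CriticalPhenomena-14132, and `DensityIntegration`, stmt-CriticalPhenomena-14890; nothing is
asserted here): frozen matching, `weight h = Σ_{ω ⊆ E} ∏_{c ∈ cornerSet (piece M)} turnFactor h (cfgOf ω) c`,
the strand expansion of `Zins`, and the insertion dictionary `‖Zins V ι‖ = #{rainbow}`.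

## References

* R. J. Baxter, S. B. Kelland, F. Y. Wu, J. Phys. A 9 (1976) 397–406, §3–§4. [BaxterKellandWu1976]
* H. Duminil-Copin, K. K. Kozlowski, P. Lammers, I. Manolescu, arXiv:2603.06268 (2026), §3.2. [DKLM2026SixVertexGFF]
-/

namespace Literature.Probability.LatticeModels

namespace CollarLegModel

open Finset

/-- A lattice point of `ℤ × ℤ` as a site `Fin 2 → ℤ` (the vertex type of the medial / percolation
files; the literal `![v.1, v.2]` of the crux stubs, `= (finTwoArrowEquiv ℤ).symm v`;
`CollarDomain.ofSites s = s.image ofSite`). [folklore] -/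
def toSite (v : ℤ × ℤ) : Site 2 := ![v.1, v.2]

/-- A site `Fin 2 → ℤ` as a point of `ℤ × ℤ`. [folklore] -/
def ofSite (x : Site 2) : ℤ × ℤ := (x 0, x 1)

/-- `ofSite ∘ toSite = id`. [folklore] -/
@[simp] theorem ofSite_toSite (v : ℤ × ℤ) : ofSite (toSite v) = v := by
  simp [ofSite, toSite]

/-- `toSite v = toSite w ↔ v = w`. [folklore] -/
theorem toSite_inj {v w : ℤ × ℤ} : toSite v = toSite w ↔ v = w :=
  ⟨fun h => by rw [← ofSite_toSite v, ← ofSite_toSite w, h], fun h => by rw [h]⟩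

/-- A coded edge `(u, dir)` of `SixVertex` as an (unordered) lattice edge of `Site 2`. [folklore] -/
def edgeSym2 (e : (ℤ × ℤ) × Bool) : Sym2 (Site 2) := s(toSite e.1, toSite (SixVertex.edgeTip e))

variable (M : CollarLegModel)

/-- **The piece** of the collar model: its vertex-cells (`V` and the ghosts) as sites; the medial
strands of the model live on the corners over this piece (`Percolation.cornerSet`). [cite: BaxterKellandWu1976, §3] -/
def piece : Finset (Site 2) := M.vertexCells.image toSite

/-- **The completed bond configuration** of a set `ω` of live edges: `ω` together with the frozen
OPEN edges of the model (spokes and ghost edges, rule (D2)), as a bond configuration on `Site 2`.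
Meant for `ω ⊆ M.E` (then every frozen closed edge, in particular every exterior edge of the
closed collar, is absent); the definition accepts any `ω` (junk otherwise) and downstream
statements quantify `ω ⊆ M.E` / `ω ∈ M.E.powerset`. [cite: BaxterKellandWu1976, §3] -/
def cfgOf (ω : Finset ((ℤ × ℤ) × Bool)) : Percolation.BondConfig (Site 2) :=
  ↑((ω ∪ M.openEdges).image edgeSym2)

/-- **Tracked corners**: the corner `c = (x, k)` (at the vertex `x`, in the face `cFace c`) is
tracked iff `x` is a vertex-cell and `cFace c` a face-cell of the model — the level line element
between two cells of the height model. [cite: BaxterKellandWu1976, §4] -/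
def IsTracked (c : Site 2 × Fin 4) : Prop :=
  ofSite c.1 ∈ M.vertexCells ∧ ofSite (cFace c) ∈ M.faceCells

/-- Trackedness is decidable. [folklore] -/
instance (c : Site 2 × Fin 4) : Decidable (M.IsTracked c) := by
  unfold IsTracked; infer_instance

/-- The target medial vertex of the corner `c` is a LIVE edge of the model. [folklore] -/
def TargetsLive (c : Site 2 × Fin 4) : Prop := cTgt c ∈ M.E.image edgeSym2

/-- Liveness of the target is decidable. [folklore] -/
instance (c : Site 2 × Fin 4) : Decidable (M.TargetsLive c) := by
  unfold TargetsLive; infer_instance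

open scoped Classical in
/-- **The turn factor** of the corner `c` for the height configuration `h` in the completed
configuration `β`. Let `c' = nextCorner β c`. Along an OPEN target edge the level line runs inside
the face `f = cFace c = cFace c'` from the vertex `x` of `c` to the vertex `x'` of `c'`: the turn
is consistent iff both corners are tracked and `h x = h x'`, and then contributes
`phase (h f - h x)` (rule (D2) / the open pairing of rule (B)). Across a CLOSED target edge it runs
around the vertex `x` from the face `f = cFace c` to `f' = cFace c'`: consistent iff both corners
are tracked and `h f = h f'`, contributing `phase (h x - h f)` (rules (C) / the closed pairing of
(B)). An inconsistent or untracked turn contributes `0` if the target edge is live (the pairing is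
absent from the six-vertex weight) and `1` if it is frozen (a defect, rule (D1)). [cite: BaxterKellandWu1976, §4] -/
noncomputable def turnFactor (h : ↥M.freeCells → ℤ) (β : Percolation.BondConfig (Site 2))
    (c : Site 2 × Fin 4) : ℂ :=
  if cTgt c ∈ β then
    if M.IsTracked c ∧ M.IsTracked (nextCorner β c) ∧
        M.hv h (ofSite c.1) = M.hv h (ofSite (nextCorner β c).1) then
      phase (M.hf h (ofSite (cFace c)) - M.hv h (ofSite c.1))
    else if M.TargetsLive c then 0 else 1
  else
    if M.IsTracked c ∧ M.IsTracked (nextCorner β c) ∧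
        M.hf h (ofSite (cFace c)) = M.hf h (ofSite (cFace (nextCorner β c))) then
      phase (M.hv h (ofSite c.1) - M.hf h (ofSite (cFace c)))
    else if M.TargetsLive c then 0 else 1

/-- The turn factor depends on the configuration only through the state of the target edge
(locality of the turning rule). [cite: BaxterKellandWu1976, §4] -/
theorem turnFactor_congr (h : ↥M.freeCells → ℤ) {β β' : Percolation.BondConfig (Site 2)}
    {c : Site 2 × Fin 4} (hc : cTgt c ∈ β ↔ cTgt c ∈ β') :
    M.turnFactor h β c = M.turnFactor h β' c := by
  classical
  unfold turnFactor
  by_cases hb : cTgt c ∈ β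
  · have hb' : cTgt c ∈ β' := hc.1 hb
    rw [if_pos hb, if_pos hb', nextCorner_of_mem hb, nextCorner_of_mem hb']
  · have hb' : cTgt c ∉ β' := fun h' => hb (hc.2 h')
    rw [if_neg hb, if_neg hb', nextCorner_of_not_mem hb, nextCorner_of_not_mem hb']



/-! ### Phase arithmetic -/
/-- `phase 2 + phase (-2) = e^{iπ/6} + e^{-iπ/6} = √3` (the c-weight at `q = 1`). [cite: BaxterKellandWu1976, §4] -/
theorem phase_two_add_phase_neg_two : phase 2 + phase (-2) = ((Real.sqrt 3 : ℝ) : ℂ) := by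
  have h : phase 2 + phase (-2) = 2 * Complex.cos ((Real.pi / 6 : ℝ) : ℂ) := by
    rw [Complex.two_cos, phase, phase]
    congr 1 <;> congr 1 <;> push_cast <;> ring
  rw [h, ← Complex.ofReal_cos, Real.cos_pi_div_six]
  push_cast
  ring

/-- **The six-vertex table at `q = 1` as a sum over the two pairings, on heights.** For the four
heights `a = h x`, `b = h y`, `p = h f`, `q = h g` around a live edge `{x, y}` with side faces
`f, g`, at unit distance across the four corners: (closed pairing: both level lines cross the edge,
consistent iff `p = q`, phases `e^{iμ(a-p)} e^{iμ(b-q)}`) + (open pairing: both follow the edge,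
consistent iff `a = b`, phases `e^{iμ(p-a)} e^{iμ(q-b)}`) = `√3` in the c-type case `a = b ∧ p = q`
and `1` otherwise. [cite: BaxterKellandWu1976, §4] -/
theorem sixVertex_split_heights {a b p q : ℤ} (h1 : |a - p| = 1) (h2 : |a - q| = 1) (h3 : |b - p| = 1)
    (h4 : |b - q| = 1) :
    (if p = q then phase (a - p) else 0) * (if q = p then phase (b - q) else 0) +
        (if a = b then phase (p - a) else 0) * (if b = a then phase (q - b) else 0) =
      if a = b ∧ q = p then ((Real.sqrt 3 : ℝ) : ℂ) else 1 := by
  rw [abs_eq (zero_le_one' ℤ)] at h1 h2 h3 h4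
  by_cases hab : a = b <;> by_cases hpq : p = q
  · subst hab; subst hpq
    simp only [and_self, if_true]
    rw [phase_mul_phase, phase_mul_phase]
    rcases h1 with h | h
    · rw [show a - p + (a - p) = 2 by omega, show p - a + (p - a) = -2 by omega]
      exact phase_two_add_phase_neg_two
    · rw [show a - p + (a - p) = -2 by omega, show p - a + (p - a) = 2 by omega, add_comm]
      exact phase_two_add_phase_neg_two
  · subst hab
    have hqp : ¬q = p := fun h => hpq h.symm
    simp only [hpq, hqp, if_false, zero_mul, zero_add, if_true, and_false]
    rw [phase_mul_phase, show p - a + (q - a) = 0 by omega]; simp [phase]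
  · subst hpq
    have hba : ¬b = a := fun h => hab h.symm
    simp only [hab, hba, if_false, zero_mul, add_zero, if_true, false_and]
    rw [phase_mul_phase, show a - p + (b - p) = 0 by omega]; simp [phase]
  · exfalso; omega

/-! ### The two corners arriving at a coded edge -/

section Corners
/-- The corner at the first endpoint of a coded edge arriving at it (face below / east). [folklore] -/
def cIn (e : (ℤ × ℤ) × Bool) : Site 2 × Fin 4 := (toSite e.1, if e.2 then 0 else 3)

/-- The corner at the far endpoint of a coded edge arriving at it (face above / west). [folklore] -/
def cOut (e : (ℤ × ℤ) × Bool) : Site 2 × Fin 4 := (toSite (SixVertex.edgeTip e), if e.2 then 2 else 1)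

/-- Unit steps from a lattice point, in `Site 2`. [folklore] -/
theorem toSite_add_cornerUnit (v : ℤ × ℤ) (k : Fin 4) :
    toSite v + cornerUnit k = toSite (![(v.1 + 1, v.2), (v.1, v.2 + 1), (v.1 - 1, v.2), (v.1, v.2 - 1)] k) := by
  funext i; fin_cases k <;> fin_cases i <;> simp [toSite, cornerUnit] <;> ring

/-- `cIn e` arrives at the medial vertex on `e`. [folklore] -/
theorem cTgt_cIn (e : (ℤ × ℤ) × Bool) : cTgt (cIn e) = edgeSym2 e := by
  obtain ⟨u, d⟩ := e
  have h3 : ((3 : Fin 4) + 1) = 0 := by decide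
  have h0 : ((0 : Fin 4) + 1) = 1 := by decide
  cases d
  · rw [cIn, cTgt, edgeSym2]
    dsimp only
    rw [if_neg (by decide), h3, toSite_add_cornerUnit]
    rfl
  · rw [cIn, cTgt, edgeSym2]
    dsimp only
    rw [if_pos rfl, h0, toSite_add_cornerUnit]
    rfl

/-- `cOut e` arrives at the medial vertex on `e`. [folklore] -/
theorem cTgt_cOut (e : (ℤ × ℤ) × Bool) : cTgt (cOut e) = edgeSym2 e := by
  obtain ⟨u, d⟩ := e
  have h1 : ((1 : Fin 4) + 1) = 2 := by decide
  have h2 : ((2 : Fin 4) + 1) = 3 := by decide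
  cases d
  · rw [cOut, cTgt, edgeSym2, Sym2.eq_swap]
    dsimp only
    rw [if_neg (by decide), h1, toSite_add_cornerUnit]
    congr 1
    simp [SixVertex.edgeTip]
  · rw [cOut, cTgt, edgeSym2, Sym2.eq_swap]
    dsimp only
    rw [if_pos rfl, h2, toSite_add_cornerUnit]
    congr 1
    simp [SixVertex.edgeTip]

/-! ### Geometry of the two corners arriving at a coded edge -/
/-- The `k`-th face around a lattice point, read back in `ℤ × ℤ`. [folklore] -/
theorem ofSite_cFace_toSite (v : ℤ × ℤ) (k : Fin 4) :
    ofSite (cFace (toSite v, k)) = ![v, (v.1 - 1, v.2), (v.1 - 1, v.2 - 1), (v.1, v.2 - 1)] k := by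
  fin_cases k <;> simp [ofSite, toSite, cFace, faceAt, cornerOff]

/-- The vertex of `cIn e` is the first endpoint. [folklore] -/
@[simp] theorem ofSite_cIn_fst (e : (ℤ × ℤ) × Bool) : ofSite (cIn e).1 = e.1 := by
  simp [cIn]

/-- The vertex of `cOut e` is the far endpoint. [folklore] -/
@[simp] theorem ofSite_cOut_fst (e : (ℤ × ℤ) × Bool) : ofSite (cOut e).1 = SixVertex.edgeTip e := by
  simp [cOut]

/-- The face of `cIn e` is the right face of `e`. [folklore] -/
theorem ofSite_cFace_cIn (e : (ℤ × ℤ) × Bool) : ofSite (cFace (cIn e)) = SixVertex.leftFace e false := by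
  obtain ⟨u, d⟩ := e
  cases d
  · rw [cIn]; dsimp only; rw [if_neg (by decide), ofSite_cFace_toSite]; rfl
  · rw [cIn]; dsimp only; rw [if_pos rfl, ofSite_cFace_toSite]; rfl

/-- The face after the LEFT turn of `cIn e` is the left face of `e`. [folklore] -/
theorem ofSite_cFace_cIn_succ (e : (ℤ × ℤ) × Bool) :
    ofSite (cFace ((cIn e).1, (cIn e).2 + 1)) = SixVertex.leftFace e true := by
  obtain ⟨u, d⟩ := e
  have h3 : ((3 : Fin 4) + 1) = 0 := by decide
  have h0 : ((0 : Fin 4) + 1) = 1 := by decide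
  cases d
  · rw [cIn]; dsimp only; rw [if_neg (by decide), h3, ofSite_cFace_toSite]; rfl
  · rw [cIn]; dsimp only; rw [if_pos rfl, h0, ofSite_cFace_toSite]; rfl

/-- The face of `cOut e` is the left face of `e`. [folklore] -/
theorem ofSite_cFace_cOut (e : (ℤ × ℤ) × Bool) : ofSite (cFace (cOut e)) = SixVertex.leftFace e true := by
  obtain ⟨u, d⟩ := e
  cases d
  · rw [cOut]; dsimp only; rw [if_neg (by decide), ofSite_cFace_toSite]; simp [SixVertex.edgeTip, SixVertex.leftFace]
  · rw [cOut]; dsimp only; rw [if_pos rfl, ofSite_cFace_toSite]; simp [SixVertex.edgeTip, SixVertex.leftFace]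

/-- The face after the LEFT turn of `cOut e` is the right face of `e`. [folklore] -/
theorem ofSite_cFace_cOut_succ (e : (ℤ × ℤ) × Bool) :
    ofSite (cFace ((cOut e).1, (cOut e).2 + 1)) = SixVertex.leftFace e false := by
  obtain ⟨u, d⟩ := e
  have h1 : ((1 : Fin 4) + 1) = 2 := by decide
  have h2 : ((2 : Fin 4) + 1) = 3 := by decide
  cases d
  · rw [cOut]; dsimp only; rw [if_neg (by decide), h1, ofSite_cFace_toSite]; simp [SixVertex.edgeTip, SixVertex.leftFace]
  · rw [cOut]; dsimp only; rw [if_pos rfl, h2, ofSite_cFace_toSite]; simp [SixVertex.edgeTip, SixVertex.leftFace]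

/-- After the RIGHT turn of `cIn e` (along the open edge) the level line is at the far endpoint. [folklore] -/
theorem ofSite_cIn_fst_add (e : (ℤ × ℤ) × Bool) :
    ofSite ((cIn e).1 + cornerUnit ((cIn e).2 + 1)) = SixVertex.edgeTip e := by
  obtain ⟨u, d⟩ := e
  have h3 : ((3 : Fin 4) + 1) = 0 := by decide
  have h0 : ((0 : Fin 4) + 1) = 1 := by decide
  cases d
  · rw [cIn]; dsimp only; rw [if_neg (by decide), h3, toSite_add_cornerUnit, ofSite_toSite]; rfl
  · rw [cIn]; dsimp only; rw [if_pos rfl, h0, toSite_add_cornerUnit, ofSite_toSite]; rfl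

/-- After the RIGHT turn of `cOut e` the level line is at the first endpoint. [folklore] -/
theorem ofSite_cOut_fst_add (e : (ℤ × ℤ) × Bool) :
    ofSite ((cOut e).1 + cornerUnit ((cOut e).2 + 1)) = e.1 := by
  obtain ⟨u, d⟩ := e
  have h1 : ((1 : Fin 4) + 1) = 2 := by decide
  have h2 : ((2 : Fin 4) + 1) = 3 := by decide
  cases d
  · rw [cOut]; dsimp only; rw [if_neg (by decide), h1, toSite_add_cornerUnit, ofSite_toSite]
    simp [SixVertex.edgeTip]
  · rw [cOut]; dsimp only; rw [if_pos rfl, h2, toSite_add_cornerUnit, ofSite_toSite]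
    simp [SixVertex.edgeTip]

/-- Along an open edge the face is kept: the face of the corner after the right turn of `cIn e`. [folklore] -/
theorem ofSite_cFace_cIn_open (e : (ℤ × ℤ) × Bool) :
    ofSite (cFace ((cIn e).1 + cornerUnit ((cIn e).2 + 1), (cIn e).2 + 3)) = SixVertex.leftFace e false := by
  have h : cFace ((cIn e).1 + cornerUnit ((cIn e).2 + 1), (cIn e).2 + 3) = cFace (cIn e) := by
    have := @cFace_nextCorner_of_mem {cTgt (cIn e)} (cIn e) (Set.mem_singleton _)
    rwa [nextCorner_of_mem (Set.mem_singleton _)] at this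
  rw [h, ofSite_cFace_cIn]

/-- The face of the corner after the right turn of `cOut e`. [folklore] -/
theorem ofSite_cFace_cOut_open (e : (ℤ × ℤ) × Bool) :
    ofSite (cFace ((cOut e).1 + cornerUnit ((cOut e).2 + 1), (cOut e).2 + 3)) = SixVertex.leftFace e true := by
  have h : cFace ((cOut e).1 + cornerUnit ((cOut e).2 + 1), (cOut e).2 + 3) = cFace (cOut e) := by
    have := @cFace_nextCorner_of_mem {cTgt (cOut e)} (cOut e) (Set.mem_singleton _)
    rwa [nextCorner_of_mem (Set.mem_singleton _)] at this
  rw [h, ofSite_cFace_cOut]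

/-! ### The split theorem -/

section Split
variable (M : CollarLegModel)

/-- The side faces of a coded edge are faces around its first endpoint. [folklore] -/
theorem leftFace_mem_vertexFaces (e : (ℤ × ℤ) × Bool) (b : Bool) :
    SixVertex.leftFace e b ∈ SixVertex.vertexFaces e.1 := by
  obtain ⟨u, d⟩ := e
  cases d <;> cases b <;> simp [SixVertex.leftFace, SixVertex.vertexFaces]

/-- A side face of a live edge is a face-cell. [folklore] -/
theorem leftFace_mem_faceCells {e : (ℤ × ℤ) × Bool} (he : e.1 ∈ M.V) (b : Bool) :
    SixVertex.leftFace e b ∈ M.faceCells := by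
  rw [faceCells, SixVertex.faces, mem_biUnion]
  exact ⟨e.1, he, leftFace_mem_vertexFaces e b⟩

/-- A vertex of `V` is a vertex-cell. [folklore] -/
theorem mem_vertexCells_of_mem {x : ℤ × ℤ} (hx : x ∈ M.V) : x ∈ M.vertexCells :=
  mem_union_left _ hx

/-- **The six-vertex weight at a live edge is the sum over its two pairings of the products of
the turn factors of the two arriving corners** (closed: both level lines cross the edge, turning
left; open: both follow it, turning right), provided the four heights around the edge are at unit
distance across its four corners. [cite: BaxterKellandWu1976, §4] -/
theorem liveWeight_eq_turnFactor_split (h : ↥M.freeCells → ℤ) {e : (ℤ × ℤ) × Bool} (he : e ∈ M.E)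
    {β₀ β₁ : Percolation.BondConfig (Site 2)} (h₀ : edgeSym2 e ∉ β₀) (h₁ : edgeSym2 e ∈ β₁)
    (v1 : |M.hv h e.1 - M.hf h (SixVertex.leftFace e false)| = 1)
    (v2 : |M.hv h e.1 - M.hf h (SixVertex.leftFace e true)| = 1)
    (v3 : |M.hv h (SixVertex.edgeTip e) - M.hf h (SixVertex.leftFace e false)| = 1)
    (v4 : |M.hv h (SixVertex.edgeTip e) - M.hf h (SixVertex.leftFace e true)| = 1) :
    M.liveWeight h e =
      M.turnFactor h β₀ (cIn e) * M.turnFactor h β₀ (cOut e) +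
        M.turnFactor h β₁ (cIn e) * M.turnFactor h β₁ (cOut e) := by
  classical
  have he' : e.1 ∈ M.V ∧ SixVertex.edgeTip e ∈ M.V := by
    have := he; rw [E, inducedEdges, mem_filter] at this; exact this.2
  have hx := M.mem_vertexCells_of_mem he'.1
  have hy := M.mem_vertexCells_of_mem he'.2
  have hfF := M.leftFace_mem_faceCells he'.1 false
  have hfT := M.leftFace_mem_faceCells he'.1 true
  have hIn₀ : cTgt (cIn e) ∉ β₀ := by rwa [cTgt_cIn]
  have hOut₀ : cTgt (cOut e) ∉ β₀ := by rwa [cTgt_cOut]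
  have hIn₁ : cTgt (cIn e) ∈ β₁ := by rwa [cTgt_cIn]
  have hOut₁ : cTgt (cOut e) ∈ β₁ := by rwa [cTgt_cOut]
  have hlive : M.TargetsLive (cIn e) := by rw [TargetsLive, cTgt_cIn]; exact mem_image_of_mem _ he
  have hlive' : M.TargetsLive (cOut e) := by rw [TargetsLive, cTgt_cOut]; exact mem_image_of_mem _ he
  -- the four turn factors, unfolded
  have e1 : M.turnFactor h β₀ (cIn e) = if M.hf h (SixVertex.leftFace e false) = M.hf h (SixVertex.leftFace e true)
      then phase (M.hv h e.1 - M.hf h (SixVertex.leftFace e false)) else 0 := by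
    rw [turnFactor, if_neg hIn₀, nextCorner_of_not_mem hIn₀]
    simp only [IsTracked, ofSite_cIn_fst, ofSite_cFace_cIn, ofSite_cFace_cIn_succ, hx, hfF, hfT, true_and, hlive,
      if_true]
  have e2 : M.turnFactor h β₀ (cOut e) = if M.hf h (SixVertex.leftFace e true) = M.hf h (SixVertex.leftFace e false)
      then phase (M.hv h (SixVertex.edgeTip e) - M.hf h (SixVertex.leftFace e true)) else 0 := by
    rw [turnFactor, if_neg hOut₀, nextCorner_of_not_mem hOut₀]
    simp only [IsTracked, ofSite_cOut_fst, ofSite_cFace_cOut, ofSite_cFace_cOut_succ, hy, hfF, hfT, true_and, hlive',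
      if_true]
  have e3 : M.turnFactor h β₁ (cIn e) = if M.hv h e.1 = M.hv h (SixVertex.edgeTip e)
      then phase (M.hf h (SixVertex.leftFace e false) - M.hv h e.1) else 0 := by
    rw [turnFactor, if_pos hIn₁, nextCorner_of_mem hIn₁]
    simp only [IsTracked, ofSite_cIn_fst, ofSite_cFace_cIn, ofSite_cIn_fst_add, ofSite_cFace_cIn_open, hx, hy, hfF,
      true_and, hlive, if_true]
  have e4 : M.turnFactor h β₁ (cOut e) = if M.hv h (SixVertex.edgeTip e) = M.hv h e.1
      then phase (M.hf h (SixVertex.leftFace e true) - M.hv h (SixVertex.edgeTip e)) else 0 := by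
    rw [turnFactor, if_pos hOut₁, nextCorner_of_mem hOut₁]
    simp only [IsTracked, ofSite_cOut_fst, ofSite_cFace_cOut, ofSite_cOut_fst_add, ofSite_cFace_cOut_open, hx, hy, hfT,
      true_and, hlive', if_true]
  rw [e1, e2, e3, e4, sixVertex_split_heights v1 v2 v3 v4, liveWeight]

end Split

end Corners

end CollarLegModel

end Literature.Probability.LatticeModels
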